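import Literature.Analysis.FluidPDE.PressurePoisson
import Literature.Analysis.FluidPDE.ClassicalDriftNSLocalEnergy
import Literature.Analysis.FluidPDE.NormalisedPressureDischarge
import Literature.Analysis.FluidPDE.HarmonicLiouvilleLp
import HarnessLib

/-!
# The pressure of Leray's regularised solutions is a polarised Riesz pressure

Analysis/FluidPDE theorem file (no definitions, no named facts). Second file of the proof that
Leray's weak solutions are suitable (see `LeraySchemeConvergence.lean`). The passage to the limit
in the local energy equality of the regularised solutions `(J_ε u, u, p)` of
`∂ₜu + ((J_ε u)·∇)u = νΔu − ∇p`, `div u = 0` (Leray 1934, (5.1)) needs the pressures in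
`L^{3/2}`, uniformly, which Leray's `L²` bound `‖p‖₂ ≤ 9 ‖|J_εu||u|‖₂` does not provide. This
file identifies the pressure of a classical solution of the drift system with a **polarised
Riesz-transform pressure**: at every interior time at which the slices have finite energy and the
three functions below are square integrable,

  `p(t) = ¼ (p̃[w(t) + u(t)] − p̃[w(t) − u(t)])`,   `p̃[v] = −|v|²/3 + p.v. K * (v ⊗ v)`

(`normalisedPressure`, Tao's normalised pressure), whence the Calderón–Zygmund bounds of the tree
(`stein1970_normalisedPressure_ae_Lp_bound_holds`) apply to `p(t)`. Ingredients, all classical: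

* `divergence_convect_eq_sum`, `divergence_convect_comm` — for divergence-free `C²` fields
  `div((w·∇)u) = tr(Du ∘ Dw) = div((u·∇)w)` (the derivative of `div u ≡ 0` kills the second-order
  term, Schwarz);
* `laplacian_pressure_eq_of_isClassicalDriftNSSolutionOn` — the pressure Poisson equation of the
  drift system, `Δp(t) = −div((w·∇)u)(t)` at interior times (the divergence of the momentum
  equation; Leray 1934, (5.1); the drift twin of `laplacian_pressure_eq_of_isClassicalNSSolutionOn`,
  Tao 2011, (8));
* `laplacian_polarisedPressure_eq` — by the classical Poisson equation of the normalised pressure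
  (`laplacian_normalisedPressure_holds`, Gilbarg–Trudinger Lemma 4.2) and polarisation,
  `Δ ¼(p̃[w+u] − p̃[w−u]) = −div((w·∇)u)` for smooth finite-energy divergence-free `u, w`;
* `pressure_eq_polarisedPressure` — the difference is a `C²` harmonic function in `L²((EuclideanSpace ℝ (Fin 3)))`, hence
  zero (`eq_zero_of_harmonic_memLp`, Liouville's theorem in `L^q`).

## References

* J. Leray, Acta Math. 63 (1934), Ch. V §26, (5.1). [Leray1934]
* T. Tao, Anal. PDE 6 (2013) = arXiv:1108.1165, (8), Lemma 4.1. [Tao2011]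
* D. Gilbarg, N. Trudinger, *Elliptic PDE of second order*, Lemma 4.2, Thm. 2.1. [GilbargTrudinger2001]
* E. M. Stein, *Singular integrals* (1970), Ch. II §4.2 Thm. 3, Ch. III §1. [Stein1970]
-/

noncomputable section

open MeasureTheory TopologicalSpace Set Function Filter Topology InnerProductSpace
open scoped RealInnerProductSpace Laplacian ContDiff ENNReal NNReal

namespace Literature.Analysis.FluidPDE

/-! ## The divergence of a convective derivative of divergence-free fields -/

section DivergenceConvect

variable {E : Type*} [NormedAddCommGroup E] [InnerProductSpace ℝ E] [FiniteDimensional ℝ E]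

omit [FiniteDimensional ℝ E] in
/-- **`div((w·∇)u) = Σⱼ ⟪bⱼ, Du(Dw bⱼ)⟫ = tr(Du ∘ Dw)` for `u ∈ C²` divergence free and `w ∈ C¹`.**
`D((w·∇)u)(x) a = D²u(x)(a)(w x) + Du(x)(Dw(x) a)`; the trace of the first term is the derivative
of `div u ≡ 0` along `w x` (Schwarz), hence vanishes. [folklore] -/
theorem divergence_convect_eq_sum {ι : Type*} [Fintype ι] (b : OrthonormalBasis ι ℝ E)
    {u w : E → E} (hu : ContDiff ℝ 2 u) (hw : ContDiff ℝ 1 w) (hdiv : VectorCalculus.IsDivFree u)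
    (x : E) :
    VectorCalculus.divergence (convect w u) x = ∑ j, ⟪b j, fderiv ℝ u x (fderiv ℝ w x (b j))⟫ := by
  set D1 : E → E →L[ℝ] E := fderiv ℝ u with hD1_def
  set D2 : E → E →L[ℝ] E →L[ℝ] E := fderiv ℝ D1 with hD2_def
  have hD1 : ContDiff ℝ 1 D1 := hu.fderiv_right (m := 1) le_rfl
  have hD1d : Differentiable ℝ D1 := hD1.differentiable one_ne_zero
  have hwd : Differentiable ℝ w := hw.differentiable one_ne_zero
  -- Schwarz for `u`
  have h22 : minSmoothness ℝ 2 ≤ (2 : ℕ∞ω) := by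
    rw [minSmoothness_of_isRCLikeNormedField]
  have hS2 : ∀ a c, D2 x a c = D2 x c a := fun a c =>
    (hu.contDiffAt.isSymmSndFDerivAt h22).eq a c
  -- the derivative of the convective term
  have hconv : convect w u = fun y => D1 y (w y) := rfl
  have hfd : ∀ a, fderiv ℝ (convect w u) x a = D2 x a (w x) + D1 x (fderiv ℝ w x a) := by
    intro a
    rw [hconv, fderiv_clm_apply (hD1d x) (hwd x)]
    simp only [add_apply, ContinuousLinearMap.coe_comp, comp_apply,
      ContinuousLinearMap.flip_apply]
    rw [add_comm]
  -- differentiated incompressibility: `Σⱼ ⟪bⱼ, D²u(a) bⱼ⟫ = 0`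
  have hdiv1 : (fun y => ∑ j, ⟪b j, D1 y (b j)⟫) = fun _ => (0 : ℝ) := by
    funext y
    rw [← divergence_eq_sum_inner_fderiv b u y]
    exact hdiv y
  have hdiv2 : ∀ a, ∑ j, ⟪b j, D2 x a (b j)⟫ = 0 := fun a => by
    have h := fderiv_sum_inner_apply_apply b (hD1d x) a
    rw [hdiv1] at h
    simpa using h.symm
  -- assemble
  rw [divergence_eq_sum_inner_fderiv b]
  simp_rw [hfd, inner_add_right, Finset.sum_add_distrib]
  have h0 : ∑ j, ⟪b j, D2 x (b j) (w x)⟫ = 0 := by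
    simp_rw [hS2 _ (w x)]
    exact hdiv2 (w x)
  rw [h0, zero_add]

/-- `Σⱼ ⟪bⱼ, A (B bⱼ)⟫ = Σⱼ ⟪bⱼ, B (A bⱼ)⟫` (`tr(AB) = tr(BA)`). [folklore] -/
theorem sum_inner_comp_comm {ι : Type*} [Fintype ι] (b : OrthonormalBasis ι ℝ E)
    (A B : E →L[ℝ] E) :
    ∑ j, ⟪b j, A (B (b j))⟫ = ∑ j, ⟪b j, B (A (b j))⟫ := by
  have hA : ∑ j, ⟪b j, A (B (b j))⟫ = LinearMap.trace ℝ E ((A : E →ₗ[ℝ] E) ∘ₗ (B : E →ₗ[ℝ] E)) := by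
    rw [LinearMap.trace_eq_sum_inner _ b]; rfl
  have hB : ∑ j, ⟪b j, B (A (b j))⟫ = LinearMap.trace ℝ E ((B : E →ₗ[ℝ] E) ∘ₗ (A : E →ₗ[ℝ] E)) := by
    rw [LinearMap.trace_eq_sum_inner _ b]; rfl
  rw [hA, hB, LinearMap.trace_comp_comm']

/-- **`div((w·∇)u) = div((u·∇)w)` for divergence-free `C²` fields** (both equal `tr(Du ∘ Dw)`).
[folklore] -/
theorem divergence_convect_comm {u w : E → E} (hu : ContDiff ℝ 2 u) (hw : ContDiff ℝ 2 w)
    (hdivu : VectorCalculus.IsDivFree u) (hdivw : VectorCalculus.IsDivFree w) (x : E) :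
    VectorCalculus.divergence (convect w u) x = VectorCalculus.divergence (convect u w) x := by
  set b := stdOrthonormalBasis ℝ E
  rw [divergence_convect_eq_sum b hu (hw.of_le (by norm_num)) hdivu,
    divergence_convect_eq_sum b hw (hu.of_le (by norm_num)) hdivw]
  exact sum_inner_comp_comm b (fderiv ℝ u x) (fderiv ℝ w x)

omit [FiniteDimensional ℝ E] in
/-- Pointwise: `((w ± u)·∇)(w ± u) = (w·∇)w ± (u·∇)w ± (w·∇)u + (u·∇)u`, i.e. the difference of
the two convective squares is `2((u·∇)w + (w·∇)u)`. [folklore] -/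
theorem convect_add_self_sub_convect_sub_self {u w : E → E} {x : E}
    (hu : DifferentiableAt ℝ u x) (hw : DifferentiableAt ℝ w x) :
    convect (w + u) (w + u) x - convect (w - u) (w - u) x = (2 : ℝ) • (convect u w x + convect w u x) := by
  simp only [convect, fderiv_add hw hu, fderiv_sub hw hu, Pi.add_apply, Pi.sub_apply,
    add_apply, sub_apply, map_add, map_sub, two_smul]
  abel

end DivergenceConvect

/-! ## The pressure Poisson equation of the drift system -/

section DriftPoisson

variable {E : Type*} [NormedAddCommGroup E] [InnerProductSpace ℝ E] [FiniteDimensional ℝ E]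

/-- **The pressure Poisson equation of the drift system** (Leray 1934, (5.1) with the divergence
taken; the drift twin of Tao 2011, (8)): for a classical solution
`IsClassicalDriftNSSolutionOn S ν w u p` of `∂ₜu + (w·∇)u = νΔu − ∇p`, `div u = div w = 0`, and an
interior time `t` of `S`, `Δ p(t)(x) = −div((w(t)·∇)u(t))(x)` for every `x`
(`div ∂ₜu = 0`, `div Δu = 0`, `div ∇p = Δp`). Any viscosity `ν`. [cite: Leray1934, Ch. V §26 (5.1)] -/
theorem laplacian_pressure_eq_of_isClassicalDriftNSSolutionOn {S : Set ℝ} {ν : ℝ} {w u : ℝ → E → E}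
    {p : ℝ → E → ℝ} (h : IsClassicalDriftNSSolutionOn S ν w u p) {t : ℝ} (ht : t ∈ interior S)
    (x : E) :
    Δ (p t) x = -VectorCalculus.divergence (convect (w t) (u t)) x := by
  -- restrict to the open set of interior times
  set S₀ := interior S with hS₀_def
  have hS₀ : IsOpen S₀ := isOpen_interior
  have h₀ : IsClassicalDriftNSSolutionOn S₀ ν w u p := h.mono interior_subset hS₀.uniqueDiffOn
  -- the two-sided time derivative and the regularity of all fields at time `t`
  set v : E → E := fun y => deriv (fun s => u s y) t with hv_def
  have hv : ContDiff ℝ ∞ v := (h₀.smooth_velocity.isSmoothSpaceTimeOn_deriv hS₀).contDiff_slice ht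
  have hu : ContDiff ℝ ∞ (u t) := h₀.smooth_velocity.contDiff_slice ht
  have hw : ContDiff ℝ ∞ (w t) := h₀.smooth_drift.contDiff_slice ht
  have hp : ContDiff ℝ ∞ (p t) := h₀.smooth_pressure.contDiff_slice ht
  have hu3 : ContDiff ℝ 3 (u t) := contDiff_infty.1 hu 3
  have hp2 : ContDiff ℝ 2 (p t) := contDiff_infty.1 hp 2
  have hvd : Differentiable ℝ v := (contDiff_infty.1 hv 1).differentiable one_ne_zero
  have hwd : Differentiable ℝ (w t) := (contDiff_infty.1 hw 1).differentiable one_ne_zero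
  have hDud : Differentiable ℝ (fderiv ℝ (u t)) :=
    ((contDiff_infty.1 hu 2).fderiv_right (m := 1) le_rfl).differentiable one_ne_zero
  have hΔd : Differentiable ℝ (Δ (u t)) := differentiable_laplacian hu3
  have hcd : Differentiable ℝ (convect (w t) (u t)) := by
    have : convect (w t) (u t) = fun y => fderiv ℝ (u t) y (w t y) := rfl
    rw [this]
    exact hDud.clm_apply hwd
  -- the momentum equation solved for the pressure gradient
  have hgrad : gradient (p t) = fun y => ν • (Δ (u t)) y - v y - convect (w t) (u t) y := by
    funext y
    have hm := h₀.momentum t ht y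
    rw [timeDerivWithin_eq_deriv hS₀ ht] at hm
    change v y + convect (w t) (u t) y = ν • (Δ (u t)) y - gradient (p t) y at hm
    rw [← sub_eq_zero] at hm ⊢
    rw [← hm]
    abel
  -- take the divergence
  have hdivv : VectorCalculus.divergence v x = 0 :=
    divergence_deriv_time_eq_zero h₀.smooth_velocity hS₀ h₀.divFree ht x
  have hdivΔ : VectorCalculus.divergence (Δ (u t)) x = 0 :=
    divergence_laplacian_eq_zero hu3 (h₀.divFree t ht) x
  have d1 : DifferentiableAt ℝ (fun y => ν • (Δ (u t)) y) x := (hΔd x).const_smul ν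
  have d2 : DifferentiableAt ℝ (fun y => ν • (Δ (u t)) y - v y) x := d1.sub (hvd x)
  rw [← divergence_gradient hp2, hgrad, divergence_sub_apply d2 (hcd x),
    divergence_sub_apply d1 (hvd x), divergence_const_smul_apply (hΔd x), hdivv, hdivΔ]
  ring

end DriftPoisson

/-! ## The polarised Riesz pressure -/

section Polarised

variable {u w : (EuclideanSpace ℝ (Fin 3)) → (EuclideanSpace ℝ (Fin 3))}

/-- Finite energy is preserved by sums. [folklore] -/
theorem lintegral_enorm_sq_pi_add_lt_top (hu : AEStronglyMeasurable u volume) (hw : AEStronglyMeasurable w volume)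
    (hu2 : (∫⁻ x, ‖u x‖ₑ ^ 2) < ⊤) (hw2 : (∫⁻ x, ‖w x‖ₑ ^ 2) < ⊤) :
    (∫⁻ x, ‖(w + u) x‖ₑ ^ 2) < ⊤ := by
  have hu' : MemLp u 2 volume := by
    refine ⟨hu, ?_⟩
    rw [eLpNorm_eq_lintegral_rpow_enorm_toReal two_ne_zero ENNReal.ofNat_ne_top, ENNReal.toReal_ofNat]
    refine ENNReal.rpow_lt_top_of_nonneg (by norm_num) (ne_of_lt ?_)
    simpa [ENNReal.rpow_two] using hu2
  have hw' : MemLp w 2 volume := by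
    refine ⟨hw, ?_⟩
    rw [eLpNorm_eq_lintegral_rpow_enorm_toReal two_ne_zero ENNReal.ofNat_ne_top, ENNReal.toReal_ofNat]
    refine ENNReal.rpow_lt_top_of_nonneg (by norm_num) (ne_of_lt ?_)
    simpa [ENNReal.rpow_two] using hw2
  have h := (hw'.add hu').eLpNorm_lt_top
  rw [eLpNorm_eq_lintegral_rpow_enorm_toReal two_ne_zero ENNReal.ofNat_ne_top, ENNReal.toReal_ofNat] at h
  have h2 := ENNReal.rpow_lt_top_of_nonneg (by norm_num : (0 : ℝ) ≤ 2) h.ne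
  rw [← ENNReal.rpow_mul, show (1 / (2 : ℝ)) * 2 = 1 by norm_num, ENNReal.rpow_one] at h2
  simpa [ENNReal.rpow_two] using h2

/-- Finite energy is preserved by differences. [folklore] -/
theorem lintegral_enorm_sq_pi_sub_lt_top (hu : AEStronglyMeasurable u volume) (hw : AEStronglyMeasurable w volume)
    (hu2 : (∫⁻ x, ‖u x‖ₑ ^ 2) < ⊤) (hw2 : (∫⁻ x, ‖w x‖ₑ ^ 2) < ⊤) :
    (∫⁻ x, ‖(w - u) x‖ₑ ^ 2) < ⊤ := by
  have h := lintegral_enorm_sq_pi_add_lt_top hu.neg hw (by simpa using hu2) hw2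
  simpa [sub_eq_add_neg] using h

/-- **The Laplacian of the polarised Riesz pressure.** For smooth, finite-energy, divergence-free
fields `u, w` on `(EuclideanSpace ℝ (Fin 3))`, the function `¼(p̃[w+u] − p̃[w−u])` is `C²` and
`Δ ¼(p̃[w+u] − p̃[w−u]) = −div((w·∇)u)`: the classical Poisson equation of the normalised pressure
`Δp̃[v] = −div((v·∇)v + (div v)v)` (`laplacian_normalisedPressure_holds`, Gilbarg–Trudinger
Lemma 4.2) for `v = w ± u`, polarisation `((w+u)·∇)(w+u) − ((w−u)·∇)(w−u) = 2((u·∇)w + (w·∇)u)`,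
and `div((u·∇)w) = div((w·∇)u)` (`divergence_convect_comm`).
[cite: GilbargTrudinger2001, Lemma 4.2] -/
theorem laplacian_polarisedPressure_eq (hu : ContDiff ℝ ∞ u) (hw : ContDiff ℝ ∞ w)
    (hdivu : VectorCalculus.IsDivFree u) (hdivw : VectorCalculus.IsDivFree w)
    (hu2 : (∫⁻ x, ‖u x‖ₑ ^ 2) < ⊤) (hw2 : (∫⁻ x, ‖w x‖ₑ ^ 2) < ⊤) :
    ContDiff ℝ 2 (fun x => 4⁻¹ * (normalisedPressure (w + u) x - normalisedPressure (w - u) x)) ∧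
      ∀ x, Δ (fun x => 4⁻¹ * (normalisedPressure (w + u) x - normalisedPressure (w - u) x)) x =
        -VectorCalculus.divergence (convect w u) x := by
  have hum : AEStronglyMeasurable u volume := hu.continuous.aestronglyMeasurable
  have hwm : AEStronglyMeasurable w volume := hw.continuous.aestronglyMeasurable
  have hplus := laplacian_normalisedPressure_holds (w + u) (hw.add hu)
    (lintegral_enorm_sq_pi_add_lt_top hum hwm hu2 hw2)
  have hminus := laplacian_normalisedPressure_holds (w - u) (hw.sub hu)
    (lintegral_enorm_sq_pi_sub_lt_top hum hwm hu2 hw2)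
  obtain ⟨hCp, hΔp⟩ := hplus
  obtain ⟨hCm, hΔm⟩ := hminus
  have hC : ContDiff ℝ 2 (fun x => 4⁻¹ * (normalisedPressure (w + u) x - normalisedPressure (w - u) x)) :=
    contDiff_const.mul (hCp.sub hCm)
  refine ⟨hC, fun x => ?_⟩
  -- the divergence-free parts of the two Poisson equations
  have hdivp : VectorCalculus.IsDivFree (w + u) := fun y => by
    have := divergence_add_apply (v := w) (w := u) (x := y)
      ((hw.differentiable (by simp)) y) ((hu.differentiable (by simp)) y)
    rw [show (fun z => w z + u z) = w + u from rfl] at this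
    rw [this, hdivw y, hdivu y, add_zero]
  have hdivm : VectorCalculus.IsDivFree (w - u) := fun y => by
    have := divergence_sub_apply (v := w) (w := u) (x := y)
      ((hw.differentiable (by simp)) y) ((hu.differentiable (by simp)) y)
    rw [show (fun z => w z - u z) = w - u from rfl] at this
    rw [this, hdivw y, hdivu y, sub_zero]
  have hΔp' : Δ (normalisedPressure (w + u)) x = -VectorCalculus.divergence (convect (w + u) (w + u)) x := by
    rw [hΔp x]
    congr 2
    funext y
    rw [hdivp y, zero_smul, add_zero]
  have hΔm' : Δ (normalisedPressure (w - u)) x = -VectorCalculus.divergence (convect (w - u) (w - u)) x := by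
    rw [hΔm x]
    congr 2
    funext y
    rw [hdivm y, zero_smul, add_zero]
  -- differentiability of the convective terms
  have hud : Differentiable ℝ u := hu.differentiable (by simp)
  have hwd : Differentiable ℝ w := hw.differentiable (by simp)
  have hconv_diff : ∀ {a v : (EuclideanSpace ℝ (Fin 3)) → (EuclideanSpace ℝ (Fin 3))}, ContDiff ℝ ∞ a → ContDiff ℝ ∞ v →
      Differentiable ℝ (convect a v) := by
    intro a v ha hv
    have : convect a v = fun y => fderiv ℝ v y (a y) := rfl
    rw [this]
    exact (((contDiff_infty.1 hv 2).fderiv_right (m := 1) le_rfl).differentiable one_ne_zero).clm_apply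
      (ha.differentiable (by simp))
  have hcp : Differentiable ℝ (convect (w + u) (w + u)) := hconv_diff (hw.add hu) (hw.add hu)
  have hcm : Differentiable ℝ (convect (w - u) (w - u)) := hconv_diff (hw.sub hu) (hw.sub hu)
  have hcuw : Differentiable ℝ (convect u w) := hconv_diff hu hw
  have hcwu : Differentiable ℝ (convect w u) := hconv_diff hw hu
  -- the Laplacian of the polarised pressure
  have hsmul : (fun x => 4⁻¹ * (normalisedPressure (w + u) x - normalisedPressure (w - u) x)) =
      (4⁻¹ : ℝ) • (normalisedPressure (w + u) - normalisedPressure (w - u)) := by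
    funext y; simp [smul_eq_mul]
  have hsub : ContDiffAt ℝ 2 (normalisedPressure (w + u) - normalisedPressure (w - u)) x := by
    exact (hCp.sub hCm).contDiffAt
  rw [hsmul, laplacian_smul _ hsub, (hCp.contDiffAt).laplacian_sub hCm.contDiffAt,
    hΔp', hΔm', smul_eq_mul]
  -- the algebra of the divergences
  have hdiff : VectorCalculus.divergence (convect (w + u) (w + u)) x -
      VectorCalculus.divergence (convect (w - u) (w - u)) x =
      2 * (VectorCalculus.divergence (convect u w) x + VectorCalculus.divergence (convect w u) x) := by
    rw [← divergence_sub_apply (hcp x) (hcm x)]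
    have hfun : (fun y => convect (w + u) (w + u) y - convect (w - u) (w - u) y) =
        fun y => (2 : ℝ) • (convect u w y + convect w u y) := by
      funext y
      exact convect_add_self_sub_convect_sub_self (hud y) (hwd y)
    have hadd : DifferentiableAt ℝ (fun y => convect u w y + convect w u y) x := (hcuw x).add (hcwu x)
    rw [hfun, divergence_const_smul_apply (v := fun y => convect u w y + convect w u y) hadd,
      divergence_add_apply (hcuw x) (hcwu x)]
  have hcomm : VectorCalculus.divergence (convect u w) x = VectorCalculus.divergence (convect w u) x :=
    (divergence_convect_comm (contDiff_infty.1 hu 2) (contDiff_infty.1 hw 2) hdivu hdivw x).symm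
  have key : -VectorCalculus.divergence (convect (w + u) (w + u)) x -
      -VectorCalculus.divergence (convect (w - u) (w - u)) x =
      -(4 * VectorCalculus.divergence (convect w u) x) := by
    rw [neg_sub_neg, ← neg_sub, hdiff, hcomm]
    ring
  rw [key]
  ring

/-- **The pressure of the drift system is the polarised Riesz pressure.** Let `u, w` be smooth,
finite-energy, divergence-free fields on `(EuclideanSpace ℝ (Fin 3))` and `p ∈ C^∞ ∩ L²` with `Δp = −div((w·∇)u)`
pointwise (the pressure Poisson equation of the drift system at an interior time,
`laplacian_pressure_eq_of_isClassicalDriftNSSolutionOn`). If `p̃[w+u], p̃[w−u] ∈ L²` (e.g. `w ± u ∈ L⁴`),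
then `p = ¼(p̃[w+u] − p̃[w−u])` everywhere: the difference is `C²`, harmonic and in `L²((EuclideanSpace ℝ (Fin 3)))`,
hence zero by Liouville's theorem in `L^q` (`eq_zero_of_harmonic_memLp`).
[cite: GilbargTrudinger2001, Thm. 2.1, Lemma 4.2] -/
theorem pressure_eq_polarisedPressure (hu : ContDiff ℝ ∞ u) (hw : ContDiff ℝ ∞ w)
    (hdivu : VectorCalculus.IsDivFree u) (hdivw : VectorCalculus.IsDivFree w)
    (hu2 : (∫⁻ x, ‖u x‖ₑ ^ 2) < ⊤) (hw2 : (∫⁻ x, ‖w x‖ₑ ^ 2) < ⊤)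
    {p : (EuclideanSpace ℝ (Fin 3)) → ℝ} (hp : ContDiff ℝ 2 p) (hpL2 : MemLp p 2 volume)
    (hΔ : ∀ x, Δ p x = -VectorCalculus.divergence (convect w u) x)
    (hplus : MemLp (normalisedPressure (w + u)) 2 volume)
    (hminus : MemLp (normalisedPressure (w - u)) 2 volume) :
    p = fun x => 4⁻¹ * (normalisedPressure (w + u) x - normalisedPressure (w - u) x) := by
  obtain ⟨hC, hΔQ⟩ := laplacian_polarisedPressure_eq hu hw hdivu hdivw hu2 hw2
  set Q : (EuclideanSpace ℝ (Fin 3)) → ℝ := fun x => 4⁻¹ * (normalisedPressure (w + u) x - normalisedPressure (w - u) x) with hQ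
  -- the difference is `C²`, harmonic and in `L²`
  have hHC : ContDiff ℝ 2 (p - Q) := hp.sub hC
  have hH0 : ∀ x, Δ (p - Q) x = 0 := fun x => by
    rw [(hp.contDiffAt).laplacian_sub hC.contDiffAt, hΔ x, hΔQ x, sub_self]
  have hQm : MemLp Q 2 volume := by
    have : Q = fun x => 4⁻¹ * (normalisedPressure (w + u) x - normalisedPressure (w - u) x) := rfl
    rw [this]
    exact (hplus.sub hminus).const_mul _
  have hHm : MemLp (p - Q) 2 volume := hpL2.sub hQm
  have hzero := eq_zero_of_harmonic_memLp (harmonicOnNhd_of_laplacian_eq_zero hHC hH0)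
    one_le_two ENNReal.ofNat_ne_top hHm
  exact sub_eq_zero.1 hzero

end Polarised

end Literature.Analysis.FluidPDE
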